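import Mathlib
import Summits.ResolutionOfSingularities.ResolutionOfSingularities.Theorems.WildQuotientsWildQuotientResolutionTwoBlocksOrder
import Summits.ResolutionOfSingularities.ResolutionOfSingularities.Theorems.WildQuotientsWildQuotientResolutionTwoBlocksChartAlgebra

/-!
# `J₂ ⊕ J₂`: the augmentation ideal of every `g ≠ 1` in `⟨σ⟩` is the centre `(x₀, x₂)` (programme T input)

(crux stmt-ResolutionOfSingularities-15640 `WildQuotients.WildQuotientResolution`, line `Sketch`,
programme «INSTANTIATE T1» = `𝔸⁴/(J₂ ⊕ J₂)` of chain w45c; [OURS · L1 W4.5c] — NOT a statement of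
any manuscript.)

Ring-level input of the S4-scheme step (stub-2's plan (B)/(C): "generators `c = (x₀, x₂)` of the
centre, fixed by the action, with `g • r - r ∈ (c)` for all `r` and `c_j ∈ ⟨g • r - r⟩`"): for the
two-block automorphism `σ` (`σ x₁ = x₁ + x₀`, `σ x₃ = x₃ + x₂`, `x₀, x₂` fixed) over a field of
characteristic `p` and `g = σⁿ ∈ ⟨σ⟩`:
* `smul_sub_mem_centre` — `g • r - r ∈ (x₀, x₂)` for every `r` (`σⁿ ≡ id mod (x₀, x₂)`);
* `X_mem_augIdeal_of_pow_apply` — if `σⁿ xᵢ = xᵢ + n xⱼ` for all `n` then `xⱼ ∈ ⟨g • r - r⟩` for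
  `g ≠ 1` (`p ∤ n`); instance `X_two_mem_augIdeal` (`x₂`, from `σⁿ x₃ - x₃ = n x₂`; the `x₀` case is
  `TwoBlocks.X_zero_mem_augIdeal` of `…TwoBlocksAssembly`);
* `augIdeal_eq_centre` — hence `⟨g • r - r : r⟩ = (x₀, x₂)` for every `g ≠ 1`: on `𝔸⁴` itself the
  augmentation ideals are the (non-principal, codimension-`2`) centre — `𝔸⁴` is NOT a terminal
  model, and the centre of programme T is forced.
-/

-- single-problem summit: the doubled namespace component `ResolutionOfSingularities` is forced
set_option linter.dupNamespace false

noncomputable section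

open MvPolynomial
open scoped Pointwise

namespace Summit.ResolutionOfSingularities.ResolutionOfSingularities.Theorems.WildQuotientResolution.TwoBlocks

/-- **`g • r ≡ r (mod (x₀, x₂))`** for every `g ∈ ⟨σ⟩`, `σ = J₂ ⊕ J₂`: true on the generators
(`σⁿ x₁ - x₁ = n x₀`, `σⁿ x₃ - x₃ = n x₂`, `x₀, x₂` fixed) and preserved under sums and products.
[folklore] -/
theorem smul_sub_mem_centre (k : Type) [Field k]
    (σ : MvPolynomial (Fin 4) k ≃ₐ[k] MvPolynomial (Fin 4) k)
    (h0 : σ (X 0) = X 0) (h1 : σ (X 1) = X 1 + X 0)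
    (h2 : σ (X 2) = X 2) (h3 : σ (X 3) = X 3 + X 2)
    (g : Subgroup.zpowers σ) (r : MvPolynomial (Fin 4) k) :
    g • r - r ∈ (Ideal.span {X 0, X 2} : Ideal (MvPolynomial (Fin 4) k)) := by
  classical
  obtain ⟨j, hj⟩ := Subgroup.mem_zpowers_iff.mp g.2
  -- write `g = σ ^ j` (`j : ℤ`) as a natural power of `σ` or of `σ⁻¹`; both are congruent to
  -- the identity modulo the centre since `σ` is: we argue directly with `τ := (g : _ ≃ₐ[k] _)`.
  set τ : MvPolynomial (Fin 4) k ≃ₐ[k] MvPolynomial (Fin 4) k :=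
    (g : MvPolynomial (Fin 4) k ≃ₐ[k] MvPolynomial (Fin 4) k) with hτ
  change τ r - r ∈ _
  -- `τ` fixes `x₀, x₂` and moves `x₁, x₃` inside the centre: from the iterate formulas
  have hX : ∀ i : Fin 4, τ (X i) - X i ∈ (Ideal.span {X 0, X 2} : Ideal (MvPolynomial (Fin 4) k)) := by
    -- reduce to natural powers of `σ` via finiteness of the order is not available for general
    -- `k`; instead use that membership in the centre is preserved by `σ` and `σ⁻¹`
    have hσX : ∀ i : Fin 4, σ (X i) - X i ∈ (Ideal.span {X 0, X 2} : Ideal (MvPolynomial (Fin 4) k)) := by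
      intro i
      match i with
      | 0 => rw [h0, sub_self]; exact Ideal.zero_mem _
      | 1 => rw [h1, add_sub_cancel_left]; exact Ideal.subset_span (Set.mem_insert _ _)
      | 2 => rw [h2, sub_self]; exact Ideal.zero_mem _
      | 3 =>
        rw [h3, add_sub_cancel_left]
        exact Ideal.subset_span (Set.mem_insert_of_mem _ rfl)
    -- `σ` preserves the centre
    have hσI : ∀ f, f ∈ (Ideal.span {X 0, X 2} : Ideal (MvPolynomial (Fin 4) k)) →
        σ f ∈ (Ideal.span {X 0, X 2} : Ideal (MvPolynomial (Fin 4) k)) := by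
      intro f hf
      have hmap := stub_twoBlocks_map_centre k σ h0 h2
      have : σ f ∈ Ideal.map (σ : MvPolynomial (Fin 4) k →+* MvPolynomial (Fin 4) k)
          (Ideal.span {X 0, X 2}) := Ideal.mem_map_of_mem _ hf
      rwa [hmap] at this
    -- every `f` satisfies `σ f - f ∈ I`, by induction on `f`
    have hσf : ∀ f : MvPolynomial (Fin 4) k,
        σ f - f ∈ (Ideal.span {X 0, X 2} : Ideal (MvPolynomial (Fin 4) k)) := by
      intro f
      induction f using MvPolynomial.induction_on with
      | C c =>
        have hc : σ (C c) = C c := σ.commutes c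
        rw [hc, sub_self]; exact Ideal.zero_mem _
      | add f g hf hg =>
        have : σ (f + g) - (f + g) = (σ f - f) + (σ g - g) := by rw [map_add]; ring
        rw [this]; exact Ideal.add_mem _ hf hg
      | mul_X f i hf =>
        have : σ (f * X i) - f * X i = (σ f - f) * σ (X i) + f * (σ (X i) - X i) := by
          rw [map_mul]; ring
        rw [this]
        exact Ideal.add_mem _ (Ideal.mul_mem_right _ _ hf) (Ideal.mul_mem_left _ _ (hσX i))
    -- and so does `σ⁻¹`: `σ⁻¹ f - f = -(σ⁻¹ (σ f' ) ...)`; use `σ⁻¹ f - f = -(σ h - h)` with `h = σ⁻¹ f`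
    have hσinvf : ∀ f : MvPolynomial (Fin 4) k,
        σ⁻¹ f - f ∈ (Ideal.span {X 0, X 2} : Ideal (MvPolynomial (Fin 4) k)) := by
      intro f
      have h := hσf (σ⁻¹ f)
      have e : σ (σ⁻¹ f) = f := by
        rw [← AlgEquiv.mul_apply, mul_inv_cancel, AlgEquiv.one_apply]
      rw [e] at h
      -- `h : f - σ⁻¹ f ∈ I`
      have : σ⁻¹ f - f = -(f - σ⁻¹ f) := by ring
      rw [this]
      exact neg_mem h
    -- integer powers
    have hzpow : ∀ (j : ℤ) (f : MvPolynomial (Fin 4) k),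
        (σ ^ j) f - f ∈ (Ideal.span {X 0, X 2} : Ideal (MvPolynomial (Fin 4) k)) := by
      intro j
      induction j using Int.induction_on with
      | zero => intro f; rw [zpow_zero, AlgEquiv.one_apply, sub_self]; exact Ideal.zero_mem _
      | succ n ih =>
        intro f
        rw [zpow_add_one, AlgEquiv.mul_apply]
        have e : (σ ^ (n : ℤ)) (σ f) - f = ((σ ^ (n : ℤ)) (σ f) - σ f) + (σ f - f) := by ring
        rw [e]
        exact Ideal.add_mem _ (ih (σ f)) (hσf f)
      | pred n ih =>
        intro f
        rw [zpow_sub_one, AlgEquiv.mul_apply]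
        have e : (σ ^ (-(n : ℤ))) (σ⁻¹ f) - f =
            ((σ ^ (-(n : ℤ))) (σ⁻¹ f) - σ⁻¹ f) + (σ⁻¹ f - f) := by ring
        rw [e]
        exact Ideal.add_mem _ (ih (σ⁻¹ f)) (hσinvf f)
    intro i
    rw [← hj]
    exact hzpow j (X i)
  induction r using MvPolynomial.induction_on with
  | C c =>
    have hc : τ (C c) = C c := τ.commutes c
    rw [hc, sub_self]; exact Ideal.zero_mem _
  | add f g' hf hg =>
    have : τ (f + g') - (f + g') = (τ f - f) + (τ g' - g') := by rw [map_add]; ring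
    rw [this]; exact Ideal.add_mem _ hf hg
  | mul_X f i hf =>
    have : τ (f * X i) - f * X i = (τ f - f) * τ (X i) + f * (τ (X i) - X i) := by
      rw [map_mul]; ring
    rw [this]
    exact Ideal.add_mem _ (Ideal.mul_mem_right _ _ hf) (Ideal.mul_mem_left _ _ (hX i))

/-- **A coordinate moved by `n` times another lies in every augmentation ideal**: if
`σ ^ p = 1` and `σⁿ xᵢ = xᵢ + n xⱼ` for all `n`, then for `g = σⁿ ≠ 1` in `⟨σ⟩` one has `p ∤ n`, so
`xⱼ = n⁻¹ (g • xᵢ - xᵢ) ∈ ⟨g • r - r⟩`. [folklore] -/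
theorem X_mem_augIdeal_of_pow_apply (p : ℕ) (hp : p.Prime) (k : Type) [Field k] [CharP k p]
    (σ : MvPolynomial (Fin 4) k ≃ₐ[k] MvPolynomial (Fin 4) k) (hσp : σ ^ p = 1) (i j : Fin 4)
    (hij : ∀ n : ℕ, (σ ^ n) (X i) = X i + (n : MvPolynomial (Fin 4) k) * X j)
    (g : Subgroup.zpowers σ) (hg : g ≠ 1) :
    (X j : MvPolynomial (Fin 4) k) ∈
      Ideal.span (Set.range fun b : MvPolynomial (Fin 4) k => g • b - b) := by
  classical
  have hfin : IsOfFinOrder σ := isOfFinOrder_iff_pow_eq_one.mpr ⟨p, hp.pos, hσp⟩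
  obtain ⟨n, hn⟩ : (g : MvPolynomial (Fin 4) k ≃ₐ[k] MvPolynomial (Fin 4) k) ∈ Submonoid.powers σ :=
    hfin.mem_powers_iff_mem_zpowers.mpr g.2
  have hn' : σ ^ n = (g : MvPolynomial (Fin 4) k ≃ₐ[k] MvPolynomial (Fin 4) k) := hn
  have hndvd : ¬ p ∣ n := by
    rintro ⟨m, rfl⟩
    apply hg
    apply Subtype.ext
    change (g : MvPolynomial (Fin 4) k ≃ₐ[k] MvPolynomial (Fin 4) k) = 1
    rw [← hn', pow_mul, hσp, one_pow]
  have hnk : (n : k) ≠ 0 := fun h => hndvd ((CharP.cast_eq_zero_iff k p n).mp h)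
  have hsmul : g • (X i : MvPolynomial (Fin 4) k) - X i = (n : MvPolynomial (Fin 4) k) * X j := by
    change (g : MvPolynomial (Fin 4) k ≃ₐ[k] MvPolynomial (Fin 4) k) (X i) - X i = _
    rw [← hn', hij n]
    ring
  have hxj : (X j : MvPolynomial (Fin 4) k) =
      C ((n : k)⁻¹) * (g • (X i : MvPolynomial (Fin 4) k) - X i) := by
    rw [hsmul, ← mul_assoc, ← map_natCast (C : k →+* MvPolynomial (Fin 4) k) n, ← map_mul,
      inv_mul_cancel₀ hnk, map_one, one_mul]
  rw [hxj]
  exact Ideal.mul_mem_left _ _ (Ideal.subset_span ⟨X i, rfl⟩)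

/-- **`x₂` lies in the augmentation ideal of every non-trivial element of `⟨σ⟩`** (`σ = J₂ ⊕ J₂`
over a field of characteristic `p`): `σⁿ x₃ - x₃ = n x₂`. [folklore] -/
theorem X_two_mem_augIdeal (p : ℕ) (hp : p.Prime) (k : Type) [Field k] [CharP k p]
    (σ : MvPolynomial (Fin 4) k ≃ₐ[k] MvPolynomial (Fin 4) k)
    (h0 : σ (X 0) = X 0) (h1 : σ (X 1) = X 1 + X 0)
    (h2 : σ (X 2) = X 2) (h3 : σ (X 3) = X 3 + X 2)
    (g : Subgroup.zpowers σ) (hg : g ≠ 1) :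
    (X 2 : MvPolynomial (Fin 4) k) ∈
      Ideal.span (Set.range fun b : MvPolynomial (Fin 4) k => g • b - b) :=
  X_mem_augIdeal_of_pow_apply p hp k σ (stub_twoBlocks_order p hp k σ h0 h1 h2 h3).1 3 2
    (fun n => (twoBlocks_pow_apply_X k σ h0 h1 h2 h3 n).2.2.2) g hg

/-- **On `𝔸⁴` the augmentation ideal of every `g ≠ 1` in `⟨σ⟩` IS the centre `(x₀, x₂)`**
(`σ = J₂ ⊕ J₂`, characteristic `p`): `⟨g • r - r : r ∈ k[x]⟩ = (x₀, x₂)` — `⊆` by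
`smul_sub_mem_centre`, `⊇` by `X_zero_mem_augIdeal` / `X_two_mem_augIdeal`. In particular the
augmentation ideals on `𝔸⁴` are not principal (the centre has codimension `2`): `𝔸⁴` is not a
terminal model, and the blow-up of programme T is along exactly this ideal. [folklore] -/
theorem augIdeal_eq_centre (p : ℕ) (hp : p.Prime) (k : Type) [Field k] [CharP k p]
    (σ : MvPolynomial (Fin 4) k ≃ₐ[k] MvPolynomial (Fin 4) k)
    (h0 : σ (X 0) = X 0) (h1 : σ (X 1) = X 1 + X 0)
    (h2 : σ (X 2) = X 2) (h3 : σ (X 3) = X 3 + X 2)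
    (g : Subgroup.zpowers σ) (hg : g ≠ 1) :
    Ideal.span (Set.range fun r : MvPolynomial (Fin 4) k => g • r - r) = Ideal.span {X 0, X 2} := by
  apply le_antisymm
  · refine Ideal.span_le.mpr ?_
    rintro _ ⟨r, rfl⟩
    exact smul_sub_mem_centre k σ h0 h1 h2 h3 g r
  · refine Ideal.span_le.mpr ?_
    intro x hx
    rcases hx with rfl | hx
    · -- `x₀`: `σⁿ x₁ - x₁ = n x₀` (this is `TwoBlocks.X_zero_mem_augIdeal` of `…TwoBlocksAssembly`)
      exact X_mem_augIdeal_of_pow_apply p hp k σ (stub_twoBlocks_order p hp k σ h0 h1 h2 h3).1 1 0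
        (fun n => (twoBlocks_pow_apply_X k σ h0 h1 h2 h3 n).2.1) g hg
    · rw [Set.mem_singleton_iff] at hx
      subst hx
      exact X_two_mem_augIdeal p hp k σ h0 h1 h2 h3 g hg

end Summit.ResolutionOfSingularities.ResolutionOfSingularities.Theorems.WildQuotientResolution.TwoBlocks

end
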